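import Summits.Ventures.Crystal3D.Theorems.StickyWulffConstantGenericWallFloorStackLedgerLocalWordTilt
import Summits.Ventures.Crystal3D.Theorems.StickyWulffConstantGenericWallFloorStackLedgerLocalWordTwo
import Summits.Ventures.Crystal3D.Theorems.StickyWulffConstantGenericWallFloorStackLedgerLocalWordFarTwo
import HarnessLib

/-!
# The level-two word cells of the `Σ3ᵏ` chain pairs (19480-p2 g4's `(1,0)` and `(0,1)`) with TILTED verticals
# (crux `GenericWallFloor`, stmt-Ventures-19480, line `WallLedgerG`)

HONEST FRAMING. Venture `Summits/Ventures/Crystal3D` (cell `crystal3d-full`), helper `--supports` the crux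
`GenericWallFloor` of `route-Ventures-StickyWulffConstant`, REGISTERED line `WallLedgerG`, open stub
`stub_twoSlabAdhesion`.  Rung credit only; F-C1 not moved; NOT the crux (`ExactOnly`(C12-55), `StarPairFar` remain inputs
BY NAME; the charge `½(κ₁+κ₂)` is `1` only when `κ₁ + κ₂ ≥ 2`).

19480-p2 g4's `twoSlabAdhesion_stackLedger_local_wordTwo_star` / `…_wordFarTwo_star` are the separated ledger on the
chain cells where one grain's steep slot is handed through ITS end mirror but its forced ray misses the next letter
(`not_coaxial_of_word_two`, `not_coaxial_of_word_farTwo` — both stated for arbitrary walk verticals).  With the tilted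
separated ledger `twoSlabAdhesion_stackLedger_local_sep_tilt` (19480-p1 g7) the same cells hold for slots steep only for
tilted verticals `z₁`, `z₂` (`‖z₁ − e₃‖ ≤ 1/4`, `‖z₂ + e₃‖ ≤ 1/4`; every slot of `e₃`-component `≥ 13/25` resp. `≤ −13/25`
qualifies by `exists_tilt_vertical{,_down}`), with the level-two best cappers read for those verticals:

* `twoSlabAdhesion_stackLedger_local_wordTwo_tilt`, `genericWallFloorAtCharge_wordTwo_tilt_of_far` — near grain level two;
* `twoSlabAdhesion_stackLedger_local_wordFarTwo_tilt`, `genericWallFloorAtCharge_wordFarTwo_tilt_of_far` — far grain level two.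
Conclusions at charge `½(κ₁+κ₂)`, `κᵢ = √2|⟪Aᵢuᵢ, e₃⟫|`; `c₀ = 1` by `genericWallFloorAtCharge_mono` when `κ₁ + κ₂ ≥ 2`.
WHAT THIS IS NOT: no census of the `Σ27`/`Σ81` gain here (the `Σ9` table is in `…Sigma9Tilt`/`…CoreResidualTilt`); F-C1 not moved.
-/

noncomputable section

namespace Summit.Ventures.Crystal3D.Theorems

open Summit.Ventures.Crystal3D Finset
open Literature.MathematicalPhysics.StatisticalMechanics (fccStacking barlowStacking IsHaggSeq contactDeficiency)
open scoped InnerProductSpace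

open scoped Classical in
/-- **The near-level-two word cell with tilted verticals** (p2 g4's `(1,0)`): chain pair `A₂·Λ₀ = (wordFrame A₁ (κ₀ ++ [μ₂, μ₁]))·Λ₀`,
grain 1's `z₁`-steep slot crossing its end mirror `μ₁` with the `z₁`-best capper missing `μ₂`, grain 2's `z₂`-steep slot in
the far end mirror.  Inputs `ExactOnly`(C12-55), `DoubleStarCoaxialAt`, `CapPairCoaxial`. -/
theorem twoSlabAdhesion_stackLedger_local_wordTwo_tilt
    {s₀ : EuclideanSpace ℝ (Fin 3)} (hs₀ : s₀ ∈ fccSlots)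
    (hcert : ExactOnly 0 (fccSlots.filter fun w => 0 < ⟪w, s₀⟫_ℝ))
    (hDS : ∀ F₁ F₂ : EuclideanSpace ℝ (Fin 3) ≃ₗᵢ[ℝ] EuclideanSpace ℝ (Fin 3), DoubleStarCoaxialAt F₁ F₂)
    (hCP : CapPairCoaxial)
    (A₁ : EuclideanSpace ℝ (Fin 3) ≃ₗᵢ[ℝ] EuclideanSpace ℝ (Fin 3)) (t₁ : EuclideanSpace ℝ (Fin 3))
    (A₂ : EuclideanSpace ℝ (Fin 3) ≃ₗᵢ[ℝ] EuclideanSpace ℝ (Fin 3)) (t₂ : EuclideanSpace ℝ (Fin 3))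
    {z₁ : EuclideanSpace ℝ (Fin 3)} (hz₁ : ‖z₁‖ = 1) (hze₁ : ‖z₁ - EuclideanSpace.single (2 : Fin 3) (1 : ℝ)‖ ≤ 1 / 4)
    {z₂ : EuclideanSpace ℝ (Fin 3)} (hz₂ : ‖z₂‖ = 1) (hze₂ : ‖z₂ + EuclideanSpace.single (2 : Fin 3) (1 : ℝ)‖ ≤ 1 / 4)
    {u₁ : EuclideanSpace ℝ (Fin 3)} (hu₁ : u₁ ∈ fccSlots) (hsteep₁ : Real.sqrt 2 / 2 ≤ ⟪A₁ u₁, z₁⟫_ℝ)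
    {u₂ : EuclideanSpace ℝ (Fin 3)} (hu₂ : u₂ ∈ fccSlots) (hsteep₂ : Real.sqrt 2 / 2 ≤ ⟪A₂ u₂, z₂⟫_ℝ)
    (κ₀ : List (EuclideanSpace ℝ (Fin 3))) (μ₂ μ₁ : EuclideanSpace ℝ (Fin 3)) (hκ₀ : κ₀ ≠ [])
    (hκl : ∀ μ ∈ κ₀ ++ [μ₂, μ₁], ‖μ‖ = 1 ∧
      ∀ w ∈ fccSlots, ⟪w, μ⟫_ℝ = 0 ∨ ⟪w, μ⟫_ℝ = Real.sqrt (2 / 3) ∨ ⟪w, μ⟫_ℝ = -Real.sqrt (2 / 3))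
    (hκc : List.IsChain (fun μ μ' => ⟪μ, μ'⟫_ℝ = 1 / 3 ∨ ⟪μ, μ'⟫_ℝ = -1 / 3) (κ₀ ++ [μ₂, μ₁]))
    (hA₂ : A₂ '' fccStacking 1 (Real.sqrt (2 / 3)) = (wordFrame A₁ (κ₀ ++ [μ₂, μ₁])) '' fccStacking 1 (Real.sqrt (2 / 3)))
    (hsecond : ∀ n₁ : EuclideanSpace ℝ (Fin 3), (n₁ = A₁ μ₁ ∨ n₁ = -A₁ μ₁) → ⟪A₁ u₁, n₁⟫_ℝ = Real.sqrt (2 / 3) →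
      ∀ q ∈ fccSlots, 0 < ⟪twinFrame A₁ n₁ q, n₁⟫_ℝ →
        (∀ q' ∈ fccSlots, 0 < ⟪twinFrame A₁ n₁ q', n₁⟫_ℝ → ⟪twinFrame A₁ n₁ q', z₁⟫_ℝ ≤ ⟪twinFrame A₁ n₁ q, z₁⟫_ℝ) →
        (twinFrame A₁ n₁).symm ((2 * Real.sqrt (2 / 3)) • twinFrame A₁ n₁ q - n₁) ≠ μ₂ ∧
        (twinFrame A₁ n₁).symm ((2 * Real.sqrt (2 / 3)) • twinFrame A₁ n₁ q - n₁) ≠ -μ₂)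
    (hlast : ∀ μ, (κ₀ ++ [μ₂, μ₁]).head? = some μ → ⟪A₂ u₂, wordFrame A₁ (κ₀ ++ [μ₂, μ₁]) μ⟫_ℝ = 0) :
    TwoSlabLedgerAt ((Real.sqrt 2 * |⟪A₁ u₁, EuclideanSpace.single (2 : Fin 3) (1 : ℝ)⟫_ℝ| +
        Real.sqrt 2 * |⟪A₂ u₂, EuclideanSpace.single (2 : Fin 3) (1 : ℝ)⟫_ℝ|) / 2) A₁ t₁ A₂ t₂ :=
  twoSlabAdhesion_stackLedger_local_sep_tilt hs₀ hcert hDS hCP A₁ t₁ A₂ t₂ hz₁ hze₁ hz₂ hze₂ hu₁ hsteep₁ hu₂ hsteep₂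
    {F | ∃ stk : List WalkEntry, StackSound z₁ stk ∧ StackWF z₁ stk ∧ stk.getLast? = some ⟨A₁, u₁, 0⟩ ∧
      ∃ e ∈ stk, e.frame = F}
    {F | ∃ stk : List WalkEntry, StackSound z₂ stk ∧ StackWF z₂ stk ∧ stk.getLast? = some ⟨A₂, u₂, 0⟩ ∧
      ∃ e ∈ stk, e.frame = F}
    (fun stk hS hW hl e he => ⟨stk, hS, hW, hl, e, he, rfl⟩)
    (fun stk hS hW hl e he => ⟨stk, hS, hW, hl, e, he, rfl⟩)
    (fun _ ⟨_, hS₁, hW₁, hl₁, _, he₁, hF₁⟩ _ ⟨_, hS₂, hW₂, hl₂, _, he₂, hF₂⟩ => by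
      rw [← hF₁, ← hF₂]
      exact not_coaxial_of_word_two κ₀ μ₂ μ₁ hκ₀ hκl hκc hA₂ hsecond hlast hS₁ hW₁ hl₁ hS₂ hW₂ hl₂ he₁ he₂)

open scoped Classical in
/-- **`GenericWallFloor` per pair at charge `½(κ₁+κ₂)` on the near-level-two word cell with tilted verticals**, modulo
`ExactOnly`(C12-55) and `StarPairFar`. -/
theorem genericWallFloorAtCharge_wordTwo_tilt_of_far
    {s₀ : EuclideanSpace ℝ (Fin 3)} (hs₀ : s₀ ∈ fccSlots)
    (hcert : ExactOnly 0 (fccSlots.filter fun w => 0 < ⟪w, s₀⟫_ℝ)) (hfar : StarPairFar)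
    (A₁ : EuclideanSpace ℝ (Fin 3) ≃ₗᵢ[ℝ] EuclideanSpace ℝ (Fin 3)) (t₁ : EuclideanSpace ℝ (Fin 3))
    (A₂ : EuclideanSpace ℝ (Fin 3) ≃ₗᵢ[ℝ] EuclideanSpace ℝ (Fin 3)) (t₂ : EuclideanSpace ℝ (Fin 3))
    {z₁ : EuclideanSpace ℝ (Fin 3)} (hz₁ : ‖z₁‖ = 1) (hze₁ : ‖z₁ - EuclideanSpace.single (2 : Fin 3) (1 : ℝ)‖ ≤ 1 / 4)
    {z₂ : EuclideanSpace ℝ (Fin 3)} (hz₂ : ‖z₂‖ = 1) (hze₂ : ‖z₂ + EuclideanSpace.single (2 : Fin 3) (1 : ℝ)‖ ≤ 1 / 4)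
    {u₁ : EuclideanSpace ℝ (Fin 3)} (hu₁ : u₁ ∈ fccSlots) (hsteep₁ : Real.sqrt 2 / 2 ≤ ⟪A₁ u₁, z₁⟫_ℝ)
    {u₂ : EuclideanSpace ℝ (Fin 3)} (hu₂ : u₂ ∈ fccSlots) (hsteep₂ : Real.sqrt 2 / 2 ≤ ⟪A₂ u₂, z₂⟫_ℝ)
    (κ₀ : List (EuclideanSpace ℝ (Fin 3))) (μ₂ μ₁ : EuclideanSpace ℝ (Fin 3)) (hκ₀ : κ₀ ≠ [])
    (hκl : ∀ μ ∈ κ₀ ++ [μ₂, μ₁], ‖μ‖ = 1 ∧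
      ∀ w ∈ fccSlots, ⟪w, μ⟫_ℝ = 0 ∨ ⟪w, μ⟫_ℝ = Real.sqrt (2 / 3) ∨ ⟪w, μ⟫_ℝ = -Real.sqrt (2 / 3))
    (hκc : List.IsChain (fun μ μ' => ⟪μ, μ'⟫_ℝ = 1 / 3 ∨ ⟪μ, μ'⟫_ℝ = -1 / 3) (κ₀ ++ [μ₂, μ₁]))
    (hA₂ : A₂ '' fccStacking 1 (Real.sqrt (2 / 3)) = (wordFrame A₁ (κ₀ ++ [μ₂, μ₁])) '' fccStacking 1 (Real.sqrt (2 / 3)))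
    (hsecond : ∀ n₁ : EuclideanSpace ℝ (Fin 3), (n₁ = A₁ μ₁ ∨ n₁ = -A₁ μ₁) → ⟪A₁ u₁, n₁⟫_ℝ = Real.sqrt (2 / 3) →
      ∀ q ∈ fccSlots, 0 < ⟪twinFrame A₁ n₁ q, n₁⟫_ℝ →
        (∀ q' ∈ fccSlots, 0 < ⟪twinFrame A₁ n₁ q', n₁⟫_ℝ → ⟪twinFrame A₁ n₁ q', z₁⟫_ℝ ≤ ⟪twinFrame A₁ n₁ q, z₁⟫_ℝ) →
        (twinFrame A₁ n₁).symm ((2 * Real.sqrt (2 / 3)) • twinFrame A₁ n₁ q - n₁) ≠ μ₂ ∧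
        (twinFrame A₁ n₁).symm ((2 * Real.sqrt (2 / 3)) • twinFrame A₁ n₁ q - n₁) ≠ -μ₂)
    (hlast : ∀ μ, (κ₀ ++ [μ₂, μ₁]).head? = some μ → ⟪A₂ u₂, wordFrame A₁ (κ₀ ++ [μ₂, μ₁]) μ⟫_ℝ = 0) :
    GenericWallFloorAtCharge ((Real.sqrt 2 * |⟪A₁ u₁, EuclideanSpace.single (2 : Fin 3) (1 : ℝ)⟫_ℝ| +
        Real.sqrt 2 * |⟪A₂ u₂, EuclideanSpace.single (2 : Fin 3) (1 : ℝ)⟫_ℝ|) / 2) A₁ t₁ A₂ t₂ :=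
  genericWallFloorAtCharge_of_ledger _ A₁ t₁ A₂ t₂
    (twoSlabAdhesion_stackLedger_local_wordTwo_tilt hs₀ hcert (doubleStarCoaxialAt_of_starPairFar hfar)
      (capPairCoaxial_of_starPairFar hfar) A₁ t₁ A₂ t₂ hz₁ hze₁ hz₂ hze₂ hu₁ hsteep₁ hu₂ hsteep₂ κ₀ μ₂ μ₁ hκ₀ hκl hκc hA₂
      hsecond hlast)

open scoped Classical in
/-- **The far-level-two word cell with tilted verticals** (p2 g4's `(0,1)`): chain pair
`A₂·Λ₀ = (wordFrame A₁ (μk :: μk1 :: κ₁))·Λ₀`, grain 1's `z₁`-steep slot in its end mirror, grain 2's `z₂`-steep slot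
crossing the far end mirror with the `z₂`-best capper missing `μk1`.  Inputs `ExactOnly`(C12-55), `DoubleStarCoaxialAt`,
`CapPairCoaxial`. -/
theorem twoSlabAdhesion_stackLedger_local_wordFarTwo_tilt
    {s₀ : EuclideanSpace ℝ (Fin 3)} (hs₀ : s₀ ∈ fccSlots)
    (hcert : ExactOnly 0 (fccSlots.filter fun w => 0 < ⟪w, s₀⟫_ℝ))
    (hDS : ∀ F₁ F₂ : EuclideanSpace ℝ (Fin 3) ≃ₗᵢ[ℝ] EuclideanSpace ℝ (Fin 3), DoubleStarCoaxialAt F₁ F₂)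
    (hCP : CapPairCoaxial)
    (A₁ : EuclideanSpace ℝ (Fin 3) ≃ₗᵢ[ℝ] EuclideanSpace ℝ (Fin 3)) (t₁ : EuclideanSpace ℝ (Fin 3))
    (A₂ : EuclideanSpace ℝ (Fin 3) ≃ₗᵢ[ℝ] EuclideanSpace ℝ (Fin 3)) (t₂ : EuclideanSpace ℝ (Fin 3))
    {z₁ : EuclideanSpace ℝ (Fin 3)} (hz₁ : ‖z₁‖ = 1) (hze₁ : ‖z₁ - EuclideanSpace.single (2 : Fin 3) (1 : ℝ)‖ ≤ 1 / 4)
    {z₂ : EuclideanSpace ℝ (Fin 3)} (hz₂ : ‖z₂‖ = 1) (hze₂ : ‖z₂ + EuclideanSpace.single (2 : Fin 3) (1 : ℝ)‖ ≤ 1 / 4)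
    {u₁ : EuclideanSpace ℝ (Fin 3)} (hu₁ : u₁ ∈ fccSlots) (hsteep₁ : Real.sqrt 2 / 2 ≤ ⟪A₁ u₁, z₁⟫_ℝ)
    {u₂ : EuclideanSpace ℝ (Fin 3)} (hu₂ : u₂ ∈ fccSlots) (hsteep₂ : Real.sqrt 2 / 2 ≤ ⟪A₂ u₂, z₂⟫_ℝ)
    (μk μk1 : EuclideanSpace ℝ (Fin 3)) (κ₁ : List (EuclideanSpace ℝ (Fin 3))) (hκ₁ : κ₁ ≠ [])
    (hκl : ∀ μ ∈ μk :: μk1 :: κ₁, ‖μ‖ = 1 ∧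
      ∀ w ∈ fccSlots, ⟪w, μ⟫_ℝ = 0 ∨ ⟪w, μ⟫_ℝ = Real.sqrt (2 / 3) ∨ ⟪w, μ⟫_ℝ = -Real.sqrt (2 / 3))
    (hκc : List.IsChain (fun μ μ' => ⟪μ, μ'⟫_ℝ = 1 / 3 ∨ ⟪μ, μ'⟫_ℝ = -1 / 3) (μk :: μk1 :: κ₁))
    (hA₂ : A₂ '' fccStacking 1 (Real.sqrt (2 / 3)) =
      (wordFrame A₁ (μk :: μk1 :: κ₁)) '' fccStacking 1 (Real.sqrt (2 / 3)))
    (hfirst : ∀ μ, κ₁.getLast? = some μ → ⟪u₁, μ⟫_ℝ = 0)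
    (hsecond : ∀ n₁ : EuclideanSpace ℝ (Fin 3),
      (n₁ = wordFrame A₁ (μk :: μk1 :: κ₁) μk ∨ n₁ = -wordFrame A₁ (μk :: μk1 :: κ₁) μk) →
      ⟪A₂ u₂, n₁⟫_ℝ = Real.sqrt (2 / 3) →
      ∀ q ∈ fccSlots, 0 < ⟪twinFrame A₂ n₁ q, n₁⟫_ℝ →
        (∀ q' ∈ fccSlots, 0 < ⟪twinFrame A₂ n₁ q', n₁⟫_ℝ → ⟪twinFrame A₂ n₁ q', z₂⟫_ℝ ≤ ⟪twinFrame A₂ n₁ q, z₂⟫_ℝ) →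
        (wordFrame A₁ (μk :: μk1 :: κ₁)).symm
            (A₂ ((twinFrame A₂ n₁).symm ((2 * Real.sqrt (2 / 3)) • twinFrame A₂ n₁ q - n₁))) ≠ μk1 ∧
        (wordFrame A₁ (μk :: μk1 :: κ₁)).symm
            (A₂ ((twinFrame A₂ n₁).symm ((2 * Real.sqrt (2 / 3)) • twinFrame A₂ n₁ q - n₁))) ≠ -μk1) :
    TwoSlabLedgerAt ((Real.sqrt 2 * |⟪A₁ u₁, EuclideanSpace.single (2 : Fin 3) (1 : ℝ)⟫_ℝ| +
        Real.sqrt 2 * |⟪A₂ u₂, EuclideanSpace.single (2 : Fin 3) (1 : ℝ)⟫_ℝ|) / 2) A₁ t₁ A₂ t₂ :=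
  twoSlabAdhesion_stackLedger_local_sep_tilt hs₀ hcert hDS hCP A₁ t₁ A₂ t₂ hz₁ hze₁ hz₂ hze₂ hu₁ hsteep₁ hu₂ hsteep₂
    {F | ∃ stk : List WalkEntry, StackSound z₁ stk ∧ StackWF z₁ stk ∧ stk.getLast? = some ⟨A₁, u₁, 0⟩ ∧
      ∃ e ∈ stk, e.frame = F}
    {F | ∃ stk : List WalkEntry, StackSound z₂ stk ∧ StackWF z₂ stk ∧ stk.getLast? = some ⟨A₂, u₂, 0⟩ ∧
      ∃ e ∈ stk, e.frame = F}
    (fun stk hS hW hl e he => ⟨stk, hS, hW, hl, e, he, rfl⟩)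
    (fun stk hS hW hl e he => ⟨stk, hS, hW, hl, e, he, rfl⟩)
    (fun _ ⟨_, hS₁, hW₁, hl₁, _, he₁, hF₁⟩ _ ⟨_, hS₂, hW₂, hl₂, _, he₂, hF₂⟩ => by
      rw [← hF₁, ← hF₂]
      exact not_coaxial_of_word_farTwo μk μk1 κ₁ hκ₁ hκl hκc hA₂ hfirst hsecond hS₁ hW₁ hl₁ hS₂ hW₂ hl₂ he₁ he₂)

open scoped Classical in
/-- **`GenericWallFloor` per pair at charge `½(κ₁+κ₂)` on the far-level-two word cell with tilted verticals**, modulo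
`ExactOnly`(C12-55) and `StarPairFar`. -/
theorem genericWallFloorAtCharge_wordFarTwo_tilt_of_far
    {s₀ : EuclideanSpace ℝ (Fin 3)} (hs₀ : s₀ ∈ fccSlots)
    (hcert : ExactOnly 0 (fccSlots.filter fun w => 0 < ⟪w, s₀⟫_ℝ)) (hfar : StarPairFar)
    (A₁ : EuclideanSpace ℝ (Fin 3) ≃ₗᵢ[ℝ] EuclideanSpace ℝ (Fin 3)) (t₁ : EuclideanSpace ℝ (Fin 3))
    (A₂ : EuclideanSpace ℝ (Fin 3) ≃ₗᵢ[ℝ] EuclideanSpace ℝ (Fin 3)) (t₂ : EuclideanSpace ℝ (Fin 3))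
    {z₁ : EuclideanSpace ℝ (Fin 3)} (hz₁ : ‖z₁‖ = 1) (hze₁ : ‖z₁ - EuclideanSpace.single (2 : Fin 3) (1 : ℝ)‖ ≤ 1 / 4)
    {z₂ : EuclideanSpace ℝ (Fin 3)} (hz₂ : ‖z₂‖ = 1) (hze₂ : ‖z₂ + EuclideanSpace.single (2 : Fin 3) (1 : ℝ)‖ ≤ 1 / 4)
    {u₁ : EuclideanSpace ℝ (Fin 3)} (hu₁ : u₁ ∈ fccSlots) (hsteep₁ : Real.sqrt 2 / 2 ≤ ⟪A₁ u₁, z₁⟫_ℝ)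
    {u₂ : EuclideanSpace ℝ (Fin 3)} (hu₂ : u₂ ∈ fccSlots) (hsteep₂ : Real.sqrt 2 / 2 ≤ ⟪A₂ u₂, z₂⟫_ℝ)
    (μk μk1 : EuclideanSpace ℝ (Fin 3)) (κ₁ : List (EuclideanSpace ℝ (Fin 3))) (hκ₁ : κ₁ ≠ [])
    (hκl : ∀ μ ∈ μk :: μk1 :: κ₁, ‖μ‖ = 1 ∧
      ∀ w ∈ fccSlots, ⟪w, μ⟫_ℝ = 0 ∨ ⟪w, μ⟫_ℝ = Real.sqrt (2 / 3) ∨ ⟪w, μ⟫_ℝ = -Real.sqrt (2 / 3))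
    (hκc : List.IsChain (fun μ μ' => ⟪μ, μ'⟫_ℝ = 1 / 3 ∨ ⟪μ, μ'⟫_ℝ = -1 / 3) (μk :: μk1 :: κ₁))
    (hA₂ : A₂ '' fccStacking 1 (Real.sqrt (2 / 3)) =
      (wordFrame A₁ (μk :: μk1 :: κ₁)) '' fccStacking 1 (Real.sqrt (2 / 3)))
    (hfirst : ∀ μ, κ₁.getLast? = some μ → ⟪u₁, μ⟫_ℝ = 0)
    (hsecond : ∀ n₁ : EuclideanSpace ℝ (Fin 3),
      (n₁ = wordFrame A₁ (μk :: μk1 :: κ₁) μk ∨ n₁ = -wordFrame A₁ (μk :: μk1 :: κ₁) μk) →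
      ⟪A₂ u₂, n₁⟫_ℝ = Real.sqrt (2 / 3) →
      ∀ q ∈ fccSlots, 0 < ⟪twinFrame A₂ n₁ q, n₁⟫_ℝ →
        (∀ q' ∈ fccSlots, 0 < ⟪twinFrame A₂ n₁ q', n₁⟫_ℝ → ⟪twinFrame A₂ n₁ q', z₂⟫_ℝ ≤ ⟪twinFrame A₂ n₁ q, z₂⟫_ℝ) →
        (wordFrame A₁ (μk :: μk1 :: κ₁)).symm
            (A₂ ((twinFrame A₂ n₁).symm ((2 * Real.sqrt (2 / 3)) • twinFrame A₂ n₁ q - n₁))) ≠ μk1 ∧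
        (wordFrame A₁ (μk :: μk1 :: κ₁)).symm
            (A₂ ((twinFrame A₂ n₁).symm ((2 * Real.sqrt (2 / 3)) • twinFrame A₂ n₁ q - n₁))) ≠ -μk1) :
    GenericWallFloorAtCharge ((Real.sqrt 2 * |⟪A₁ u₁, EuclideanSpace.single (2 : Fin 3) (1 : ℝ)⟫_ℝ| +
        Real.sqrt 2 * |⟪A₂ u₂, EuclideanSpace.single (2 : Fin 3) (1 : ℝ)⟫_ℝ|) / 2) A₁ t₁ A₂ t₂ :=
  genericWallFloorAtCharge_of_ledger _ A₁ t₁ A₂ t₂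
    (twoSlabAdhesion_stackLedger_local_wordFarTwo_tilt hs₀ hcert (doubleStarCoaxialAt_of_starPairFar hfar)
      (capPairCoaxial_of_starPairFar hfar) A₁ t₁ A₂ t₂ hz₁ hze₁ hz₂ hze₂ hu₁ hsteep₁ hu₂ hsteep₂ μk μk1 κ₁ hκ₁ hκl hκc hA₂
      hfirst hsecond)

end Summit.Ventures.Crystal3D.Theorems

end
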